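import Summits.NavierStokesRegularity.FluidComputer.PalasekTowerRegisterGlobalApriori

/-!
# REGISTER v2.3′: the a-priori ceiling — the upper half of heredity at the generic levels IS the
# no-overshoot bound (named form)

Cell `ns-blowup`, seat `ns-blowup-ecbridge-5` (g2); companion of
`PalasekTowerRegisterGlobalHeredity.lean` (p415576: `ContinuationEnvelope`, `ReadoutFloors`,
`HeredityFrom`), `PalasekTowerRegisterGlobalHalves.lean` (p419350:
`heredityFrom_two_iff_envelope_and_floors`) and `PalasekTowerRegisterGlobalApriori.lean` (the
a-priori continuation of a stage, `continuationEnvelope_of_apriori` /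
`apriori_of_continuationEnvelope`). LABEL: E–C typing (ONE named open `Prop` that re-types a
registered stub + its kernel-checked interlocks; every implication proved). WHAT THIS IS NOT: not
Navier–Stokes evidence — no stage, tower or instance is constructed or claimed; the
`@[conjecture]` definition is never asserted.

## Why

The registered stub `stub_continuation_envelope : ContinuationEnvelope` of the child crux
`HeredityFromTwo` (item stmt-NavierStokesRegularity-19250, skeleton `Cruxes/HeredityFromTwo/Lines/
birth.lean`) bundles two things: EXISTENCE of a finite-energy classical continuation of every
registered stage at `k ≥ 2` up to the next readout (no premature blow-up, no loss of finite
energy) and the BOUND `≤ c₂ Y_{k+1}` on it (no overshoot). `PalasekTowerRegisterGlobalApriori`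
proves the existence part from the bound in its a-priori form. This file NAMES that a-priori form,
`AprioriCeiling` — a pure `∀`-statement about finite-energy classical continuations, with no
existence clause — and records: `ContinuationEnvelope ↔ AprioriCeiling`
(`continuationEnvelope_iff_aprioriCeiling`), hence `HeredityFrom 2 ↔ AprioriCeiling ∧ ReadoutFloors`
and `EpisodeInductionG ↔ HeredityAtOne ∧ AprioriCeiling ∧ ReadoutFloors`: at the generic levels
the crux is EXACTLY two `∀`-bounds on the (unique, `Stage.continuation_velocity_eq`) continuation
of a registered stage — it never exceeds `c₂ Y_{k+1}` before `τ (k+1)`, and it shows the three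
floors of level `k + 1` at `τ (k+1)`. Regularity / existence is no longer part of the open
statement.

References: S. Palasek, arXiv:2605.13827 §4 [cite: Palasek2026ElementaryModel, §4]; J. C. Robinson,
J. L. Rodrigo, W. Sadowski, CUP 2016, Thm. 8.17 [cite: RobinsonRodrigoSadowski2016, Thm. 8.17];
T. Tao, Anal. PDE 6 (2013), Lemma 8.1, Cor. 11.4 [cite: Tao2011, Cor. 11.4].
-/

noncomputable section

namespace Summit.NavierStokesRegularity.FluidComputer.PalasekTowerClayBridge

open Set MeasureTheory Filter Topology Function Real
open scoped ENNReal ContDiff NNReal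
open Literature.Analysis.FluidPDE

/-! ## §1 The a-priori ceiling at the generic levels -/

/-- **The A-PRIORI CEILING at the generic levels** (open; never asserted; the no-overshoot half
of the registered stub `continuation_envelope`): for every pinned (`Λ = 8`, `θ = 6/5`), rigid,
quiet schedule on the wide-base rates, every `k ≥ 2`, every globally anchored registered stage
`s` at level `k` (unit viscosity) and every `T' ∈ [τ k, τ (k+1)]`, EVERY classical solution with
the schedule's force on `[0, T'] × ℝ³` which agrees with `s` in velocity and pressure on
`[0, τ k]` and has finite energy on `[0, T']` stays inside the next ceiling:
`|u| ≤ c₂ Y_{k+1}` on `[0, T'] × ℝ³`. No continuation is asserted to exist. (By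
`Stage.continuation_velocity_eq` there is at most one such continuation on each `[0, T']`: this
is a statement about THE flow of the stage for as long as it stays classical with finite
energy.) [cite: Palasek2026ElementaryModel, §4] -/
@[conjecture] def AprioriCeiling : Prop :=
  ∀ S : Schedule TowerRates.wide, S.Pins 8 (6 / 5) → S.Rigid → S.Quiet → ∀ k : ℕ, 2 ≤ k →
    ∀ s : Stage 1 TowerRates.wide S (Margins.routeG TowerRates.wide) k,
    ∀ T' ∈ Icc (S.τ k) (S.τ (k + 1)),
    ∀ (u : ℝ → EuclideanSpace ℝ (Fin 3) → EuclideanSpace ℝ (Fin 3))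
      (p : ℝ → EuclideanSpace ℝ (Fin 3) → ℝ),
      IsClassicalNSSolutionOn (Icc 0 T') 1 S.f u p →
      (∀ t ∈ Icc 0 (S.τ k), u t = s.u t ∧ p t = s.p t) →
      (∃ C : ℝ≥0∞, C < ⊤ ∧ ∀ t ∈ Icc 0 T', ∫⁻ x, ‖u t x‖ₑ ^ 2 ≤ C) →
      ∀ t ∈ Icc 0 T', ∀ x, ‖u t x‖ ≤ S.c₂ * TowerRates.wide.Y (k + 1)

/-! ## §2 The upper half IS the a-priori ceiling -/

/-- **The a-priori ceiling gives the continuation envelope**: existence of the finite-energy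
classical continuation to `τ (k+1)` is the a-priori continuation theorem
`Stage.exists_continuation_of_apriori` (Leray–Hopf from finite energy, global Leray–Hopf
extension, continuation of bounded classical representatives to a prescribed time, gluing and
pressure re-gauge), packaged as `continuationEnvelope_of_apriori`.
[cite: RobinsonRodrigoSadowski2016, Thm. 8.17] -/
theorem continuationEnvelope_of_aprioriCeiling (h : AprioriCeiling) : ContinuationEnvelope :=
  continuationEnvelope_of_apriori h

/-- **The continuation envelope gives the a-priori ceiling** (silent-window uniqueness: any
finite-energy continuation on `[0, T']` is the envelope's one there). [folklore] -/
theorem ContinuationEnvelope.aprioriCeiling (h : ContinuationEnvelope) : AprioriCeiling :=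
  apriori_of_continuationEnvelope h

/-- **`ContinuationEnvelope ↔ AprioriCeiling`**: the upper half of heredity at the generic levels
is exactly the no-overshoot bound; no existence / regularity clause remains. [folklore] -/
theorem continuationEnvelope_iff_aprioriCeiling : ContinuationEnvelope ↔ AprioriCeiling :=
  ⟨ContinuationEnvelope.aprioriCeiling, continuationEnvelope_of_aprioriCeiling⟩

/-- The crux at the generic levels yields the a-priori ceiling (so `AprioriCeiling` is a
CONSEQUENCE of `HeredityFrom 2`: refuting it refutes the crux). [folklore] -/
theorem AprioriCeiling.of_heredityFrom_two (h : HeredityFrom 2) : AprioriCeiling :=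
  (ContinuationEnvelope.of_heredityFrom_two h).aprioriCeiling

/-- K2G itself yields the a-priori ceiling. [folklore] -/
theorem EpisodeInductionG.aprioriCeiling (h : EpisodeInductionG) : AprioriCeiling :=
  h.continuationEnvelope.aprioriCeiling

/-! ## §3 The child crux and K2G re-typed: two `∀`-bounds at the generic levels -/

/-- **The a-priori ceiling and the readout floors compose to heredity from level `2`.**
[folklore] -/
theorem heredityFrom_two_of_aprioriCeiling_floors (hA : AprioriCeiling) (hB : ReadoutFloors) :
    HeredityFrom 2 :=
  heredityFrom_two_of_envelope_floors (continuationEnvelope_of_aprioriCeiling hA) hB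

/-- **`HeredityFrom 2 ↔ AprioriCeiling ∧ ReadoutFloors`** — the child crux `HeredityFromTwo` is
EXACTLY: (i) no finite-energy classical continuation of a registered stage at `k ≥ 2` overshoots
`c₂ Y_{k+1}` before `τ (k+1)`, and (ii) every such continuation to `τ (k+1)` inside the ceiling
shows the three level-`k+1` floors there. No named fact is used. [folklore] -/
theorem heredityFrom_two_iff_aprioriCeiling_and_floors :
    HeredityFrom 2 ↔ AprioriCeiling ∧ ReadoutFloors :=
  heredityFrom_two_iff_envelope_and_floors.trans
    (and_congr_left fun _ => continuationEnvelope_iff_aprioriCeiling)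

/-- **K2G re-typed**: `EpisodeInductionG ↔ HeredityAtOne ∧ AprioriCeiling ∧ ReadoutFloors`.
[folklore] -/
theorem episodeInductionG_iff_rung_aprioriCeiling_floors :
    EpisodeInductionG ↔ HeredityAtOne ∧ AprioriCeiling ∧ ReadoutFloors :=
  episodeInductionG_iff_heredityAtOne_and_heredityFrom_two.trans
    (and_congr_right fun _ => heredityFrom_two_iff_aprioriCeiling_and_floors)

/-- The composition of the birth skeleton with the re-typed upper stub: first rung + a-priori
ceiling + readout floors ⇒ K2G. [folklore] -/
theorem episodeInductionG_of_rung_aprioriCeiling_floors (hR : HeredityAtOne) (hA : AprioriCeiling)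
    (hB : ReadoutFloors) : EpisodeInductionG :=
  episodeInductionG_iff_rung_aprioriCeiling_floors.2 ⟨hR, hA, hB⟩

end Summit.NavierStokesRegularity.FluidComputer.PalasekTowerClayBridge

end
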